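import Mathlib
import Literature.AlgebraicGeometry.Resolution.PlaneGermNonNCCount
import Literature.AlgebraicGeometry.Resolution.PlaneGermBlowup
import Summits.ResolutionOfSingularities.ResolutionOfSingularities.Theorems.WeightedInvariantLocalWeightedDropBlowupSuccessorToolkit
import Summits.ResolutionOfSingularities.ResolutionOfSingularities.Theorems.WeightedInvariantLocalWeightedDropBlowupScaling
import Summits.ResolutionOfSingularities.ResolutionOfSingularities.Theorems.WeightedInvariantLocalWeightedDropNonNCCountAssembly
import Summits.ResolutionOfSingularities.ResolutionOfSingularities.Theorems.WeightedInvariantLocalWeightedDropStrictTransformOrder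
import Summits.ResolutionOfSingularities.ResolutionOfSingularities.Theorems.WeightedInvariantLocalWeightedDropExceptionalSmoothCalculus
import Summits.ResolutionOfSingularities.ResolutionOfSingularities.Theorems.WeightedInvariantLocalWeightedDropPersistentOrderPower
import Summits.ResolutionOfSingularities.ResolutionOfSingularities.Theorems.WeightedInvariantLocalWeightedDropBadChainAssembly
import Summits.ResolutionOfSingularities.ResolutionOfSingularities.Theorems.WeightedInvariantLocalWeightedDropTangentConeCut

/-!
# `WeightedInvariant.LocalWeightedDrop`, line `hasse-ridge-face-selection`: the named fact `PlaneGermNonNCCount` is a theorem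

Crux item stmt-ResolutionOfSingularities-8899 (route `ResolutionOfSingularities/WeightedInvariant`), skeleton v15 of the
line `hasse-ridge-face-selection`.

**What is proved here.**  STRONG EMBEDDED RESOLUTION OF PLANE CURVE GERMS BY POINT BLOW-UPS, over EVERY field, in the
chart vocabulary of the local resolution game: `planeGermNonNCCount : ∀ k, PlaneGermNonNCCount k` — there is a
function `ν : k[[x,y]] → ℕ` (the length of the longest chain of non-normal-crossing infinitely near points) which
vanishes exactly on the germs with normal-crossing support, is monotone under divisibility, and drops at every point of
the first blow-up (Hartshorne V.3.9; Campillo LNM 813, Ch. III; Casas-Alvero §§3.7–3.8).  It is the COMPOSITION of the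
seven landed stubs of waves 4–5:
* `stub_nonNCCountAssembly` (ν := longest bad chain; boundedness by well-founded induction + finite branching) fed with
* `stub_blowupSuccessorToolkit` (calculus of the first neighbourhood), `stub_blowupScaling` (literal chart = rescaled
  normalised chart; invariance) and the NO-INFINITE-CHAIN theorem, itself
* `stub_badChainAssembly` (exceptional/strict decomposition along a chain, order stabilisation, the `m = 0` exit, exclusion
  of vertical steps, endgame induction on `ord_x L(x,0)`) fed with `stub_strictTransformOrder`,
  `stub_exceptionalSmoothCalculus` and `stub_persistentOrderPower` (persistence of the order ⇒ unbounded contact with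
  the sheared coordinate ⇒ `u · L^m` by the landed `stub_contactApprox` + `stub_approxPowerExact`).

**Consequences recorded.**  `stub_planeNonNCCount` (the v9-registered stub, algebraically closed case, statement spelled
out) and `localWeightedDrop_of_threeCores`: the crux `LocalWeightedDrop` follows from EXACTLY the three open cores
(cubic cones with non-trivial apex; wild double points `p = 2`; tame double points in `≥ 4` variables, `p ≠ 2`) —
`TangentConeCut.localWeightedDrop_of_cores` with its first hypothesis discharged.
-/

set_option linter.dupNamespace false -- mandated namespace of this single-conjunct summit

namespace Summit.ResolutionOfSingularities.ResolutionOfSingularities.Theorems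

open Literature.AlgebraicGeometry.Resolution

/-- NO INFINITE CHAIN of non-normal-crossing infinitely near points (strong embedded resolution of plane curve germs,
every field): the chain assembly fed with the three calculus stubs. -/
theorem noInfiniteBadChain (k : Type) [Field k] (f : ℕ → MvPowerSeries (Fin 2) k) :
    ∃ i, ¬ PlaneGerm.IsBadStep (f i) (f (i + 1)) :=
  stub_badChainAssembly k (stub_strictTransformOrder k) (stub_exceptionalSmoothCalculus k)
    (stub_persistentOrderPower k) f

/-- THE NAMED FACT `PlaneGermNonNCCount` HOLDS over every field (registered stub `stub_planeNonNCCount_allFields`). -/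
theorem stub_planeNonNCCount_allFields : ∀ (k : Type) [Field k], Literature.AlgebraicGeometry.Resolution.PlaneGermNonNCCount k :=
  fun k _ => stub_nonNCCountAssembly k (stub_blowupSuccessorToolkit k) (stub_blowupScaling k)
    (noInfiniteBadChain k)

/-- The Literature named fact `Literature.AlgebraicGeometry.Resolution.PlaneGermNonNCCount k` HOLDS for every field
`k : Type`: strong embedded resolution of plane curve germs in chart form (the discharge under the conventional name
`PlaneGermNonNCCount_holds` is filed separately; this is the same theorem under a plain name). -/
theorem planeGermNonNCCount (k : Type) [Field k] : PlaneGermNonNCCount k :=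
  stub_planeNonNCCount_allFields k

/-- The v9-registered stub `stub_planeNonNCCount` (algebraically closed fields; the statement of `PlaneGermNonNCCount k`
spelled out), now a theorem. -/
theorem stub_planeNonNCCount : ∀ (k : Type) [Field k] [IsAlgClosed k],
    ∃ ν : MvPowerSeries (Fin 2) k → ℕ,
      (∀ b : MvPowerSeries (Fin 2) k, b ≠ 0 → (ν b = 0 ↔
        (∃ (Φ : Fin 2 → MvPowerSeries (Fin 2) k) (u : MvPowerSeries (Fin 2) k) (a c : ℕ),
          (∀ i, MvPowerSeries.constantCoeff (Φ i) = 0) ∧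
          IsUnit (Matrix.det (Matrix.of fun i j => MvPowerSeries.coeff (Finsupp.single j 1) (Φ i))) ∧
          MvPowerSeries.constantCoeff u ≠ 0 ∧ MvPowerSeries.subst Φ b = u * MvPowerSeries.X 0 ^ a * MvPowerSeries.X 1 ^ c))) ∧
      (∀ b d : MvPowerSeries (Fin 2) k, d ≠ 0 → b ∣ d → ν b ≤ ν d) ∧
      (∀ b : MvPowerSeries (Fin 2) k, b ≠ 0 →
        ¬ (∃ (Φ : Fin 2 → MvPowerSeries (Fin 2) k) (u : MvPowerSeries (Fin 2) k) (a c : ℕ),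
          (∀ i, MvPowerSeries.constantCoeff (Φ i) = 0) ∧
          IsUnit (Matrix.det (Matrix.of fun i j => MvPowerSeries.coeff (Finsupp.single j 1) (Φ i))) ∧
          MvPowerSeries.constantCoeff u ≠ 0 ∧ MvPowerSeries.subst Φ b = u * MvPowerSeries.X 0 ^ a * MvPowerSeries.X 1 ^ c) →
        ∀ c : Fin 2 → k, c ≠ 0 → ∀ (a : ℕ) (G : MvPowerSeries (Fin 3) k),
          MvPowerSeries.subst (CobordantChart.chart (fun _ : Fin 2 => 1) c) b = MvPowerSeries.X 0 ^ a * G →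
          ¬ (MvPowerSeries.X (0 : Fin 3) ∣ G) →
          ∃ i : Fin 2, c i ≠ 0 ∧
            ν (MvPowerSeries.X 0 * MvPowerSeries.subst (fun j : Fin 3 => if j = i.succ then (0 : MvPowerSeries (Fin 2) k)
                  else MvPowerSeries.X (Fin.predAbove i j)) G) < ν b) :=
  fun k _ _ => planeGermNonNCCount k

/-- THE CRUX MODULO EXACTLY THE THREE OPEN CORES: `LocalWeightedDrop` follows from (i) the cubic-cone core (order `≥ 3`
with a non-trivial apex of the tangent cone), (ii) the wild double-point core (`p = 2`), (iii) the tame double-point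
core in `≥ 4` variables (`p ≠ 2`) — the landed tangent-cone cut `TangentConeCut.localWeightedDrop_of_cores` with its
plane-curve input discharged by `planeGermNonNCCount`. -/
theorem localWeightedDrop_of_threeCores
    (hcubic : ∀ (p : ℕ), p.Prime → ∀ (k : Type) [Field k] [CharP k p] [IsAlgClosed k]
    (n : ℕ), (∀ m : ℕ, m < n + 3 → ∀ g : MvPowerSeries (Fin m) k,
      CobordantGame.IsSingular k g → CobordantGame.Won k m g) →
    ∀ (f : MvPowerSeries (Fin (n + 3)) k), CobordantGame.IsSingular k f →
    (∀ g : MvPowerSeries (Fin (n + 3)) k, CobordantGame.IsSingular k g → g.order < f.order →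
      CobordantGame.Won k (n + 3) g) →
    (∀ i j : Fin (n + 3), MvPowerSeries.coeff (Finsupp.single i 1 + Finsupp.single j 1) f = 0) →
    ∀ (d : ℕ), f.order = d →
    (∃ c : Fin (n + 3) → k, c ≠ 0 ∧ ∀ v : Fin (n + 3) → k,
      CobordantChart.initEval (fun _ : Fin (n + 3) => 1) (v + c) d f =
        CobordantChart.initEval (fun _ : Fin (n + 3) => 1) v d f) →
    CobordantGame.Won k (n + 3) f)
    (hwild : ∀ (k : Type) [Field k] [CharP k 2] [IsAlgClosed k]
    (n : ℕ), (∀ m : ℕ, m < n + 3 → ∀ g : MvPowerSeries (Fin m) k,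
      CobordantGame.IsSingular k g → CobordantGame.Won k m g) →
    ∀ (f : MvPowerSeries (Fin (n + 3)) k), CobordantGame.IsSingular k f →
    (∀ g : MvPowerSeries (Fin (n + 3)) k, CobordantGame.IsSingular k g → g.order < f.order →
      CobordantGame.Won k (n + 3) g) →
    (∃ ℓ : Fin (n + 3) → k, (∃ i, ℓ i ≠ 0) ∧ ∀ i j : Fin (n + 3),
      MvPowerSeries.coeff (Finsupp.single i 1 + Finsupp.single j 1) f =
        MvPowerSeries.coeff (Finsupp.single i 1 + Finsupp.single j 1)
          ((∑ l, MvPowerSeries.C (ℓ l) * MvPowerSeries.X l) ^ 2)) →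
    CobordantGame.Won k (n + 3) f)
    (htame : ∀ (p : ℕ), p.Prime → p ≠ 2 →
    ∀ (k : Type) [Field k] [CharP k p] [IsAlgClosed k]
    (n : ℕ), (∀ m : ℕ, m < n + 4 → ∀ g : MvPowerSeries (Fin m) k,
      CobordantGame.IsSingular k g → CobordantGame.Won k m g) →
    ∀ (f : MvPowerSeries (Fin (n + 4)) k), CobordantGame.IsSingular k f →
    (∀ g : MvPowerSeries (Fin (n + 4)) k, CobordantGame.IsSingular k g → g.order < f.order →
      CobordantGame.Won k (n + 4) g) →
    (∃ ℓ : Fin (n + 4) → k, (∃ i, ℓ i ≠ 0) ∧ ∀ i j : Fin (n + 4),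
      MvPowerSeries.coeff (Finsupp.single i 1 + Finsupp.single j 1) f =
        MvPowerSeries.coeff (Finsupp.single i 1 + Finsupp.single j 1)
          ((∑ l, MvPowerSeries.C (ℓ l) * MvPowerSeries.X l) ^ 2)) →
    CobordantGame.Won k (n + 4) f) :
    Summit.ResolutionOfSingularities.ResolutionOfSingularities.Theses.WeightedInvariant.LocalWeightedDrop :=
  TangentConeCut.localWeightedDrop_of_cores (fun k _ _ => planeGermNonNCCount k) hcubic hwild htame

end Summit.ResolutionOfSingularities.ResolutionOfSingularities.Theorems
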